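import Summits.BirchSwinnertonDyer.BirchSwinnertonDyer.Theses.TameQuarticManinParity
import HarnessLib

/-!
# Route `TameQuarticManinParity`, LINE 43 (bsd-idea-3 g12), glue G43 `TprimeIIINeronSaturationOfALCut`
# (stmt-BirchSwinnertonDyer-24165) — DL3 ∧ GL43 ⟹ N42, PROVED BY NAME (the planner's `Sketch43.lean` / `Glue43n.lean`)

Cell `pub/bsd-wall`, D-0145 line `route-BirchSwinnertonDyer-TeichmullerTwistDescent`, seat `bsd-line-ttd-p1` g15.
BSD is NOT proved by this; Manin's conjecture is not proved by this; the crux GL43 (`TprimeIIINeronMatchesALCut`,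
stmt-24162), the support DL3 (`TprimeALCutCongruenceWitnessAtThree`, 24163) and N42
(`TprimeIIINeronCongruenceSaturation`, 24099) stay OPEN. This file closes ONLY the glue.

## Proof

Take the AL-stable witness `h` of depth `v₃(deg φ)` (DL3: `⟨f,h⟩ = t⟨f,f⟩`, `t ≠ 0`, `v₃ t + v₃ deg φ ≤ 0`); GL43
matches it with a cusp-regular rational `g`, `⟨f,h⟩ = u⟨f,g⟩`, `v₃ u ≥ 0`; `u ≠ 0` since `t ≠ 0` and `⟨f,f⟩ > 0`
(Petersson positivity); then `⟨f,g⟩ = (t/u)⟨f,f⟩` with `v₃(t/u) ≤ −v₃(deg φ)`. THEOREMS ONLY; axioms `propext`,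
`Classical.choice`, `Quot.sound`.
-/

set_option autoImplicit false
-- D-0017: single-problem summit, so `Summit.BirchSwinnertonDyer.BirchSwinnertonDyer.…` repeats a namespace BY DESIGN.
set_option linter.dupNamespace false

namespace Summit.BirchSwinnertonDyer.BirchSwinnertonDyer.Theorems.TameQuarticManinParity

open scoped MatrixGroups ModularForm
open CongruenceSubgroup
open Summit.BirchSwinnertonDyer.BirchSwinnertonDyer.Theses.TameQuarticManinParity
open Literature.NumberTheory.EllipticCurves.ModularForms

/-- **Glue G43** (stmt-BirchSwinnertonDyer-24165), by name: the AL-cut congruence witness of depth `v₃(deg φ)` (DL3)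
and the matching «Néron lattice = AL cut along f» (GL43) give the Néron congruence witness N42.
[cite: AbbesUllmo1996, Lemme 3.1] [cite: CesnaviciusNeururerSaha2023, Thm. 5.15, Thm. 6.12 (b)] -/
theorem tprimeIIINeronSaturationOfALCut_proof : TprimeIIINeronSaturationOfALCut := by
  unfold TprimeIIINeronSaturationOfALCut TprimeIIINeronCongruenceSaturation
  intro hDL hGL W _ _ _ hadd hsub hΔ D hopt hmin _h3
  haveI : Fact (Nat.Prime 3) := ⟨Nat.prime_three⟩
  obtain ⟨M, hMint, hMst, h, hh, t, ht0, htv, hfh⟩ := hDL W hadd hsub D hopt hmin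
  obtain ⟨g, hgrat, hgreg, u, hu, hug⟩ := hGL W hadd hsub hΔ D M hMint hMst h hh
  have hff : peterssonProduct (Gamma0 (W.conductorNorm ℤ)) 2 D.f D.f ≠ 0 := by
    intro h0
    have hpos := peterssonProduct_self_pos_holds (Gamma0 (W.conductorNorm ℤ)) 2
      (IsNormalized.ne_zero D.isNewformOf.1.2.2)
    rw [h0, Complex.zero_re] at hpos
    exact lt_irrefl _ hpos
  have hu0 : u ≠ 0 := by
    rintro rfl
    rw [hug, Rat.cast_zero, zero_mul] at hfh
    exact (mul_ne_zero (Rat.cast_ne_zero.mpr ht0) hff) hfh.symm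
  refine ⟨g, hgrat, hgreg, t / u, div_ne_zero ht0 hu0, ?_, ?_⟩
  · have : padicValRat 3 (t / u) = padicValRat 3 t - padicValRat 3 u := padicValRat.div ht0 hu0
    rw [this]; linarith
  · have huC : (u : ℂ) ≠ 0 := Rat.cast_ne_zero.mpr hu0
    rw [Rat.cast_div, div_mul_eq_mul_div, eq_div_iff huC, ← hfh, hug, mul_comm]

end Summit.BirchSwinnertonDyer.BirchSwinnertonDyer.Theorems.TameQuarticManinParity
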